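import Literature.MathematicalPhysics.QuantumFieldTheory.Balaban1983to89.B9Eq3186G2Perturbation

/-!
# `Balaban1983to89.B9Eq3186QG2QInv` — T. Bałaban, *Propagators for lattice gauge theories in a background field*, Commun. Math. Phys. **99**
(1985) 389–434 [Balaban1985BackgroundPropagators], Sect. E p. 432, (3.186) «G̃₂ = G₂ − G₂Q̃\*(Q̃G₂Q̃\*)⁻¹Q̃G₂» and «This way we can express C⁽ᵏ⁾(Λ) in
terms of the operators of the type G′, (Q′G′²Q′\*)⁻¹, G, (QGQ\*)⁻¹», with p. 422 «The operators (QGQ\*)⁻¹, or (QG₁Q\*)⁻¹, can be analyzed in the same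
way as the operator (Q′G′²Q′\*)⁻¹. We will not repeat these considerations here, let us write only bounds. … (3.132)» — THE INVERSE `(Q̃G₂Q̃*)⁻¹`
AND THE (3.186) OPERATOR `G̃₂` KERNEL-CHECKED at the matrix-letter level, continuing `B9Eq3186G2Perturbation` (the G₂ − G₁ terms, G-B9-10 (a)):
(i) `Q̃G₂Q̃ᵀ > 0` and (3.186) for the covariance `flucCov K Q̃` of (3.183)/(3.185) WITHOUT invertibility hypotheses; (ii) `(Q̃G₂Q̃ᵀ)⁻¹` by THE SAME
resolvent step at `M₁ = Q̃G₁♮Q̃ᵀ` with the small symmetric perturbation `V = Q̃(G₂ − G₁♮)Q̃ᵀ = −Q̃G₁♮WG₂Q̃ᵀ`, given the (3.132)-type majorant of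
`(Q̃G₁♮Q̃ᵀ)⁻¹`; (iii) the block majorant of `G̃₂` — the input shape `S` of r1's `B9Thm315Decay.Hyp3185`/`kernel_3186` — from Theorem 3.12-type data of
`G₁♮` and the letters alone.  Cell pub-ymgap, seat dag-n06-b (N06 = [B9], -b FIRST-MISSING-ESTIMATE, Thm 3.15 chain; `--supports stmt-QuantumFields-19183`).

statement-level bookkeeping of by-reference sentences with citation tags; proofs where landed; nothing here is a claim about the Yang–Mills mass gap

CITATION HEADER (lean-in-tree rule).  B9 = [Balaban1985BackgroundPropagators] (held `paper:balaban1985-cmp99-background-propagators`, journal page =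
PDF page + 388; text pages p0034, p0044 re-read by this seat 2026-08-26).  WHAT IS PRINTED (verbatim): p. 422 [PDF 34]: «The operators (QGQ\*)⁻¹, or
(QG₁Q\*)⁻¹, can be analyzed in the same way as the operator (Q′G′²Q′\*)⁻¹. We will not repeat these considerations here, let us write only bounds. We
have |(QG₁Q\*)⁻¹(y, y′)| ≦ … e^{−δ₀d(y,y′)}, y, y′ ∈ Λ_k, (3.132) and the same for the operator with G₁ instead of G.»; p. 432 [PDF 44]: «Let us denote a
covariance operator of the Gaussian integral in (3.183) by G̃₂, then we obtain C⁽ᵏ⁾(Λ) = (I + D̄μ)QG̃₂Q\*(I + μ\*D̄\*). (3.185) It is the formula we are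
looking for. The operator G̃₂ can be related in a simple way to the operator G₂ defined by the Gaussian integral (3.183), but with the δ-function δ(Q̃A)
replaced by exp[−½⟨Q̃A, aQ̃A⟩]. We have G̃₂ = G₂ − G₂Q̃\*(Q̃G₂Q̃\*)⁻¹Q̃G₂. (3.186) The operator G₂ differs from G₁ only by the small and regular
operators … Thus we can investigate the operator G₂ perturbatively in the same way as the operator G₁ in (3.138). … This way we can express C⁽ᵏ⁾(Λ) in
terms of the operators of the type G′, (Q′G′²Q′\*)⁻¹, G, (QGQ\*)⁻¹. Expanding these into random walks we get a random walk expansion of C⁽ᵏ⁾(Λ). The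
formula (3.185) implies immediately bounds and an exponential decay. Thus we get Theorem 3.15.»  [4] = [Balaban1984PropagatorsII] (2.51)–(2.55)
p. 232, Lemma 2.1 (2.61) p. 234.

THE READING (typing choices; a typing, not a claim about the print).  As in `B9Eq3186G2Perturbation`: `G₁♮ = K₁⁻¹` is the (3.128)-type operator at the
wavy letters, `G₂ = (K₁ + W)⁻¹` with `W` the new terms; `Q̃ : Matrix τ b ℝ` the wavy averaging with `Q̃Q̃ᵀ` invertible (onto; `B9Eq3185`'s `hQM`); real
symmetric matrices, finite index types; block majorants in r16's `B11SectG` currency on the sharp-block sup sizes `BlockNorm.ofBlocks` (κ = 1) of the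
fine-bond coordinates `b` and of the `Q̃`-rows `τ`; letters at one rate `δ`, one row-sum rate `σ` per composition.  «In the same way» for
`(Q̃G₂Q̃ᵀ)⁻¹` is READ perturbatively around `M₁ = Q̃G₁♮Q̃ᵀ`, whose inverse's majorant (the (3.132)-type bound for `G₁♮`) is the by-reference INPUT.

WHAT IS PROVED (kernel; theorems only — 0 `def`, 0 named fact, 0 sorry; axioms standard).
* §1 **`posDef_sandwich`** (`G > 0`, `Q̃Q̃ᵀ` invertible ⟹ `Q̃GQ̃ᵀ > 0`), **`eq_3186_of_posDef`** ((3.186) for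
  `flucCov K Q̃` from `K + aQ̃ᵀQ̃ > 0` alone — `B9SectECov.eq_3186_scalar` with its two `IsUnit` hypotheses discharged), `G2_sub_G1`
  (`G₂ − G₁♮ = −G₁♮WG₂`), `sandwich_split`, `sandwich_sub_transpose`.
* §2 (abstract block norms) `hasMaj_GWG`, `hasMaj_sandwich`, **`hasMaj_3186_word`** (the majorant of `G₂ − G₂Q̃ᵀHQ̃G₂` from `G₂`, `Q̃`, `Q̃ᵀ`, `H`).
* §3 `mulVecLin_sandwich_diff`, **`qg2q_inverse`** — `(Q̃G₂Q̃ᵀ)⁻¹`: existence, `= M₁⁻¹(I + VM₁⁻¹)⁻¹`, positivity, Neumann series, block majorant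
  `B_M(1 − B_Mc_Vmc²)⁻¹e^{−(δ−4σ)d}` with `c_V = C_QB_Gc_WB₂C_Q′c⁴` (one factor `m = Mα₀`), by `B9Eq3186G2Perturbation.g2_expansion`/`g2_majorant`.
* §4 **`gtilde2_of_letters`** — END TO END from `K₁ > 0`, `W` symmetric small, `Q̃Q̃ᵀ` invertible, the letters `G₁♮`, `W`, `Q̃`, `Q̃ᵀ`, the (3.132)-type
  majorant of `(Q̃G₁♮Q̃ᵀ)⁻¹`, `7σ ≦ δ`, two smallness conditions: `G₂ > 0`, `Q̃G₂Q̃ᵀ > 0`, `(Q̃G₂Q̃ᵀ)⁻¹ > 0` with majorant `B_He^{−(δ−6σ)d}`, and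
  `G̃₂ = G₂ − G₂Q̃ᵀ(Q̃G₂Q̃ᵀ)⁻¹Q̃G₂` with majorant `(B₂ + B₂C_Q′B_HC_QB₂c⁴)e^{−(δ−7σ)d}`; `flucCov_eq_of_posDef` — that operator IS `flucCov K Q̃`, the
  covariance `G̃₂` of (3.183)/(3.185), whenever `K + aQ̃ᵀQ̃ = K₁ + W` (`B9Eq3186G2Perturbation.g2_of_letters` (i)).

HONEST SCOPE / NOT CLAIMED.  (i) INPUTS of printed shape: Theorem 3.12 for `G₁♮` (positivity, sup majorant) and the (3.132)-type majorant of
`(Q̃G₁♮Q̃ᵀ)⁻¹` (itself «analyzed in the same way as (Q′G′²Q′\*)⁻¹» — Theorem 3.2's proof by reference to [4], G-B9-07; NOT re-derived here), the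
letters `Q̃`, `Q̃ᵀ`, and `W`'s smallness (= `B9Eq3186G2Perturbation` §2/§5 from the (3.117)/(3.137)/J letters).  (ii) NOT the random-walk EXPANSION
(G-B9-10 (b)), NOT the kernel `(L^{j′}η)^{−d}` form nor the Euclidean-distance comparison of `B9Thm315Decay` reading (d): block majorants on sharp
blocks only (on the unit lattice with singleton blocks a sharp-block sup majorant is an entrywise kernel bound — the consumer's instantiation, not done
here); the remaining hypotheses of `B9Thm315Decay.Hyp3185` (the dressing `I + D̄μ`, the averaging `Q`, charts) are untouched.  (iii) CURRENCY CAVEAT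
C-pv21g2-1 as in r06 FILES 78–83 and `B9Eq3186G2Perturbation`; one finite lattice at a time; explicit, crude constants; rates degrade by `σ` per
composition («after adjusting a definition of δ₀», p. 427).  NOT summit progress; N06 is NOT discharged by this file.

RELATED IN THE TREE, NOT DUPLICATED (searched 2026-08-26): `B9SectECov.eq_3186_scalar` ((3.186) under two `IsUnit` hypotheses — USED, discharged
here), `B9Thm315Decay.kernel_3186` (kernel-level bookkeeping of (3.186) from four kernel-bound hypotheses — different currency, consumer side),
`B9Eq3132QGtildeQInvLetterClosed`/`B9Ineq3133KernelConcrete` ((3.132)/(3.133) for the Sect.-D `G`, `G₁` — the input shape, other carriers),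
`B9Eq3185.eq_3185_via_G2`.  USED BY NAME: `B9Eq3186G2Perturbation.g2_expansion`/`g2_majorant`, `B9SectECov.eq_3186_scalar`, `B11SectG.hasMaj_comp_exp`/
`HasMaj.sub/.neg/.mono/.of_rate_le`, Mathlib `Matrix.PosDef.mul_mul_conjTranspose_same`/`PosDef.inv`.  Unit `pub-ymgap-dag-n06-b` (g2), HOME
`run/shared/lean/pub/pub-ymgap/`.

v1.1 (g2, APPEND-ONLY over v1 p417363 ✓ 764f585cf37f; every v1 declaration byte-identical): §5 KERNEL FORM — `abs_entry_le_of_hasMaj` (a non-negative block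
majorant between sharp-block sup sizes bounds every matrix entry) and **`kernel_of_sandwich`** (`|(QG̃₂Qᵀ)(p, q)| ≤ C_Q(BC_Q′c)c·e^{−ρd(y(p),y(q))}` from the
majorants of `G̃₂`, `Q`, `Qᵀ` — the `hS` shape of `B9Thm315Decay.Rep3185` ∕ `B9Eq3187Op.rep3185Dom_of_op` in the block map's distance).
-/

noncomputable section

open scoped BigOperators Matrix

namespace Literature.MathematicalPhysics.QuantumFieldTheory.Balaban1983to89.B9Eq3186QG2QInv

open Literature.MathematicalPhysics.QuantumFieldTheory.Balaban1983to89
open B11SectG B6RandomWalk B9Eq3186G2Perturbation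

/-! ## §1 Positivity: `Q̃G₂Q̃*` and (3.186) without invertibility hypotheses -/

section Positivity

variable {b τ : Type*} [Fintype b] [Fintype τ] [DecidableEq b] [DecidableEq τ]

omit [DecidableEq b] in
/-- **positivity of the sandwich**: `G > 0` and `Q̃Q̃ᵀ` invertible ⟹ `Q̃GQ̃ᵀ > 0` (Mathlib `Matrix.PosDef.mul_mul_conjTranspose_same`, injectivity of
`v ↦ vQ̃` by `B9SectECov.eq_zero_of_constraint`; the `IsUnit`-det form for `G = H⁻¹` is [this lineage's] `B9Eq3112.isUnit_det_QHinvQt`); for `G = G₂`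
this is the existence of `(Q̃G₂Q̃*)⁻¹` in (3.186). [cite: Balaban1985BackgroundPropagators, (3.186) p.432] -/
theorem posDef_sandwich (G : Matrix b b ℝ) (hG : G.PosDef) (Qt : Matrix τ b ℝ) (hQ : IsUnit (Qt * Qtᵀ).det) :
    (Qt * G * Qtᵀ).PosDef := by
  have hinj : Function.Injective Qt.vecMul := by
    intro x₁ x₂ hx
    rw [← sub_eq_zero] at hx ⊢
    rw [← Matrix.sub_vecMul] at hx
    exact B9SectECov.eq_zero_of_constraint hQ hx
  have h := hG.mul_mul_conjTranspose_same (B := Qt) hinj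
  rwa [Matrix.conjTranspose_eq_transpose_of_trivial] at h

/-- **(3.186) WITHOUT invertibility hypotheses**: if the form `K + aQ̃ᵀQ̃` of `G₂` is positive (`B9Eq3186G2Perturbation.g2_of_letters` (ii)) and
`Q̃Q̃ᵀ` is invertible, then `Q̃G₂Q̃ᵀ > 0` and the constrained covariance `G̃₂ = flucCov K Q̃` of the `δ(Q̃A)`-Gaussian integral (3.183)
satisfies «G̃₂ = G₂ − G₂Q̃*(Q̃G₂Q̃*)⁻¹Q̃G₂ (3.186)» — `B9SectECov.eq_3186_scalar` with both `IsUnit` hypotheses DISCHARGED.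
[cite: Balaban1985BackgroundPropagators, (3.185)–(3.186) p.432] -/
theorem eq_3186_of_posDef (K : Matrix b b ℝ) (Qt : Matrix τ b ℝ) (a : ℝ) (hK₂ : (K + a • (Qtᵀ * Qt)).PosDef)
    (hQ : IsUnit (Qt * Qtᵀ).det) :
    (Qt * (K + a • (Qtᵀ * Qt))⁻¹ * Qtᵀ).PosDef ∧
    Beta.CompositionSingular.flucCov K Qt = (K + a • (Qtᵀ * Qt))⁻¹ -
      (K + a • (Qtᵀ * Qt))⁻¹ * Qtᵀ * (Qt * (K + a • (Qtᵀ * Qt))⁻¹ * Qtᵀ)⁻¹ * Qt * (K + a • (Qtᵀ * Qt))⁻¹ := by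
  have hP := posDef_sandwich _ hK₂.inv Qt hQ
  exact ⟨hP, B9SectECov.eq_3186_scalar K Qt a ((Matrix.isUnit_iff_isUnit_det _).mp hK₂.isUnit)
    ((Matrix.isUnit_iff_isUnit_det _).mp hP.isUnit)⟩

/-- the resolvent identity behind «perturbatively»: `(K₁ + W)G₂ = I` ⟹ `G₂ − G₁♮ = −G₁♮WG₂` (`G₁♮ = K₁⁻¹`) — the difference carries the small
factor of `W`. [cite: Balaban1985BackgroundPropagators, p.432 (after (3.186)), (3.138) p.423] -/
theorem G2_sub_G1 (K₁ W G₂ : Matrix b b ℝ) (hK₁ : IsUnit K₁.det) (hG₂ : (K₁ + W) * G₂ = 1) :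
    G₂ - K₁⁻¹ = -(K₁⁻¹ * W * G₂) := by
  have h := congrArg (fun M => K₁⁻¹ * M) hG₂
  simp only [Matrix.mul_add, Matrix.add_mul, ← Matrix.mul_assoc, Matrix.nonsing_inv_mul _ hK₁, Matrix.one_mul,
    Matrix.mul_one] at h
  rw [sub_eq_iff_eq_add, neg_add_eq_sub, eq_sub_iff_add_eq]
  exact h

omit [DecidableEq b] [Fintype τ] [DecidableEq τ] in
/-- `Q̃G₂Q̃ᵀ = Q̃G₁Q̃ᵀ + Q̃(G₂ − G₁)Q̃ᵀ`. [cite: Balaban1985BackgroundPropagators, (3.186) p.432] -/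
theorem sandwich_split (G₁ G₂ : Matrix b b ℝ) (Qt : Matrix τ b ℝ) :
    Qt * G₂ * Qtᵀ = Qt * G₁ * Qtᵀ + Qt * (G₂ - G₁) * Qtᵀ := by
  rw [Matrix.mul_sub, Matrix.sub_mul, add_sub_cancel]

omit [DecidableEq τ] [Fintype τ] in
/-- the perturbation `V = Q̃(G₂ − G₁♮)Q̃ᵀ` is symmetric for symmetric `K₁`, `G₂`. [cite: Balaban1985BackgroundPropagators, (3.186) p.432] -/
theorem sandwich_sub_transpose (K₁ G₂ : Matrix b b ℝ) (hK₁ : K₁ᵀ = K₁) (hG₂ : G₂ᵀ = G₂) (Qt : Matrix τ b ℝ) :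
    (Qt * (G₂ - K₁⁻¹) * Qtᵀ)ᵀ = Qt * (G₂ - K₁⁻¹) * Qtᵀ := by
  rw [Matrix.transpose_mul, Matrix.transpose_mul, Matrix.transpose_transpose, Matrix.transpose_sub,
    Matrix.transpose_nonsing_inv, hK₁, hG₂, Matrix.mul_assoc]

end Positivity

/-! ## §2 Block majorants: the difference `G₂ − G₁♮`, its `Q̃`-sandwich, the (3.186) word -/

section Letters

variable {g : B6.Geometry} {FX FT : Type} [AddCommGroup FX] [Module ℝ FX] [AddCommGroup FT] [Module ℝ FT]
variable {bX : BlockNorm g FX} {bT : BlockNorm g FT}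

/-- **the word `G₁♮WG₂`**: `G₂` (`B₂e^{−δd}`), `W` SMALL (`c_W·m·e^{−δd}`), `G₁♮` (`B_Ge^{−δd}`) ⟹ `κB_G(κc_WmB₂c)c·e^{−ρd}` for `ρ + σ ≦ δ` — one factor
`m = Mα₀`. [cite: Balaban1985BackgroundPropagators, p.432 (after (3.186)), (3.138) p.423] [cite: Balaban1984PropagatorsII, (2.52)–(2.55) p.232, (2.61) p.234] -/
theorem hasMaj_GWG {G1f Wf G2f : FX →ₗ[ℝ] FX} {BG cW m B₂ δ ρ σ c : ℝ}
    (htri : Triangle254 g) (hd : ∀ a b : g.Site, 0 ≤ g.dist a b) (hrow : RowSum g σ c) (hc0 : 0 ≤ c)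
    (hBG : 0 ≤ BG) (hcW : 0 ≤ cW) (hm : 0 ≤ m) (hB₂ : 0 ≤ B₂) (hρ : 0 ≤ ρ) (hσ : 0 ≤ σ) (hρδ : ρ + σ ≤ δ)
    (hG1 : HasMaj bX bX G1f (fun a b => BG * Real.exp (-(δ * g.dist a b))))
    (hW : HasMaj bX bX Wf (fun a b => cW * m * Real.exp (-(δ * g.dist a b))))
    (hG2 : HasMaj bX bX G2f (fun a b => B₂ * Real.exp (-(δ * g.dist a b)))) :
    HasMaj bX bX (G1f ∘ₗ (Wf ∘ₗ G2f))
      (fun a b => bX.κ * BG * (bX.κ * (cW * m) * B₂ * c) * c * Real.exp (-(ρ * g.dist a b))) := by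
  have h1 : HasMaj bX bX (Wf ∘ₗ G2f) (fun a b => bX.κ * (cW * m) * B₂ * c * Real.exp (-(ρ * g.dist a b))) :=
    hasMaj_comp_exp htri hd hrow (mul_nonneg hcW hm) hB₂ hρ (by linarith) hρδ hW hG2
  exact hasMaj_comp_exp htri hd hrow hBG
    (mul_nonneg (mul_nonneg (mul_nonneg bX.κ_nonneg (mul_nonneg hcW hm)) hB₂) hc0) hρ le_rfl hρδ hG1 h1

/-- **the sandwich `Q̃XQ̃ᵀ`**: `Q̃ᵀ : bT → bX` (`C_Q′`), `X : bX → bX` (`C_X`), `Q̃ : bX → bT` (`C_Q`) ⟹ `κC_Q(κC_XC_Q′c)c·e^{−ρd}`.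
[cite: Balaban1985BackgroundPropagators, (3.186) p.432] [cite: Balaban1984PropagatorsII, (2.52)–(2.55) p.232, (2.61) p.234] -/
theorem hasMaj_sandwich {Qf : FX →ₗ[ℝ] FT} {Xf : FX →ₗ[ℝ] FX} {Qtf : FT →ₗ[ℝ] FX} {CQ CX CQ' δ ρ σ c : ℝ}
    (htri : Triangle254 g) (hd : ∀ a b : g.Site, 0 ≤ g.dist a b) (hrow : RowSum g σ c) (hc0 : 0 ≤ c)
    (hCQ : 0 ≤ CQ) (hCX : 0 ≤ CX) (hCQ' : 0 ≤ CQ') (hρ : 0 ≤ ρ) (hσ : 0 ≤ σ) (hρδ : ρ + σ ≤ δ)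
    (hQ : HasMaj bX bT Qf (fun a b => CQ * Real.exp (-(δ * g.dist a b))))
    (hX : HasMaj bX bX Xf (fun a b => CX * Real.exp (-(δ * g.dist a b))))
    (hQt : HasMaj bT bX Qtf (fun a b => CQ' * Real.exp (-(δ * g.dist a b)))) :
    HasMaj bT bT (Qf ∘ₗ (Xf ∘ₗ Qtf))
      (fun a b => bX.κ * CQ * (bX.κ * CX * CQ' * c) * c * Real.exp (-(ρ * g.dist a b))) := by
  have h1 : HasMaj bT bX (Xf ∘ₗ Qtf) (fun a b => bX.κ * CX * CQ' * c * Real.exp (-(ρ * g.dist a b))) :=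
    hasMaj_comp_exp htri hd hrow hCX hCQ' hρ (by linarith) hρδ hX hQt
  exact hasMaj_comp_exp htri hd hrow hCQ
    (mul_nonneg (mul_nonneg (mul_nonneg bX.κ_nonneg hCX) hCQ') hc0) hρ le_rfl hρδ hQ h1

/-- **the (3.186) word `G̃₂ = G₂ − G₂Q̃ᵀHQ̃G₂`** (`H = (Q̃G₂Q̃ᵀ)⁻¹`): from `G₂` (`B₂`), `Q̃` (`C_Q`), `Q̃ᵀ` (`C_Q′`), `H` (`B_H`), all at the rate `δ`,
`G̃₂` has the majorant `(B₂ + κ_XB₂(κ_TC_Q′(κ_TB_H(κ_XC_QB₂c)c)c)c)·e^{−ρd}` for `ρ + σ ≦ δ` («A summation preserves it also»).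
[cite: Balaban1985BackgroundPropagators, (3.186) p.432] [cite: Balaban1984PropagatorsII, (2.52)–(2.55) p.232, (2.61) p.234] -/
theorem hasMaj_3186_word {G2f : FX →ₗ[ℝ] FX} {Qf : FX →ₗ[ℝ] FT} {Qtf : FT →ₗ[ℝ] FX} {Hf : FT →ₗ[ℝ] FT}
    {B₂ CQ CQ' BH δ ρ σ c : ℝ}
    (htri : Triangle254 g) (hd : ∀ a b : g.Site, 0 ≤ g.dist a b) (hrow : RowSum g σ c) (hc0 : 0 ≤ c)
    (hB₂ : 0 ≤ B₂) (hCQ : 0 ≤ CQ) (hCQ' : 0 ≤ CQ') (hBH : 0 ≤ BH) (hρ : 0 ≤ ρ) (hσ : 0 ≤ σ) (hρδ : ρ + σ ≤ δ)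
    (hG2 : HasMaj bX bX G2f (fun a b => B₂ * Real.exp (-(δ * g.dist a b))))
    (hQ : HasMaj bX bT Qf (fun a b => CQ * Real.exp (-(δ * g.dist a b))))
    (hQt : HasMaj bT bX Qtf (fun a b => CQ' * Real.exp (-(δ * g.dist a b))))
    (hH : HasMaj bT bT Hf (fun a b => BH * Real.exp (-(δ * g.dist a b)))) :
    HasMaj bX bX (G2f - G2f ∘ₗ (Qtf ∘ₗ (Hf ∘ₗ (Qf ∘ₗ G2f))))
      (fun a b => (B₂ + bX.κ * B₂ * (bT.κ * CQ' * (bT.κ * BH * (bX.κ * CQ * B₂ * c) * c) * c) * c) *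
        Real.exp (-(ρ * g.dist a b))) := by
  have h0 := hG2.of_rate_le hd hB₂ (show ρ ≤ δ by linarith)
  have h1 : HasMaj bX bT (Qf ∘ₗ G2f) (fun a b => bX.κ * CQ * B₂ * c * Real.exp (-(ρ * g.dist a b))) :=
    hasMaj_comp_exp htri hd hrow hCQ hB₂ hρ (by linarith) hρδ hQ hG2
  have h1c : 0 ≤ bX.κ * CQ * B₂ * c := mul_nonneg (mul_nonneg (mul_nonneg bX.κ_nonneg hCQ) hB₂) hc0
  have h2 : HasMaj bX bT (Hf ∘ₗ (Qf ∘ₗ G2f))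
      (fun a b => bT.κ * BH * (bX.κ * CQ * B₂ * c) * c * Real.exp (-(ρ * g.dist a b))) :=
    hasMaj_comp_exp htri hd hrow hBH h1c hρ le_rfl hρδ hH h1
  have h2c : 0 ≤ bT.κ * BH * (bX.κ * CQ * B₂ * c) * c := mul_nonneg (mul_nonneg (mul_nonneg bT.κ_nonneg hBH) h1c) hc0
  have h3 : HasMaj bX bX (Qtf ∘ₗ (Hf ∘ₗ (Qf ∘ₗ G2f)))
      (fun a b => bT.κ * CQ' * (bT.κ * BH * (bX.κ * CQ * B₂ * c) * c) * c * Real.exp (-(ρ * g.dist a b))) :=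
    hasMaj_comp_exp htri hd hrow hCQ' h2c hρ le_rfl hρδ hQt h2
  have h3c : 0 ≤ bT.κ * CQ' * (bT.κ * BH * (bX.κ * CQ * B₂ * c) * c) * c :=
    mul_nonneg (mul_nonneg (mul_nonneg bT.κ_nonneg hCQ') h2c) hc0
  have h4 : HasMaj bX bX (G2f ∘ₗ (Qtf ∘ₗ (Hf ∘ₗ (Qf ∘ₗ G2f))))
      (fun a b => bX.κ * B₂ * (bT.κ * CQ' * (bT.κ * BH * (bX.κ * CQ * B₂ * c) * c) * c) * c *
        Real.exp (-(ρ * g.dist a b))) :=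
    hasMaj_comp_exp htri hd hrow hB₂ h3c hρ le_rfl hρδ hG2 h3
  exact (h0.sub h4).mono fun a b => le_of_eq (by ring)

end Letters

/-! ## §3 `(Q̃G₂Q̃*)⁻¹` «analyzed in the same way»: the resolvent step at `Q̃G₁♮Q̃*` -/

section Inverse

variable {g : B6.Geometry} {b τ : Type} [Fintype b] [Fintype τ] [DecidableEq b] [DecidableEq τ]

omit [DecidableEq τ] in
/-- the perturbation as a word in the matrix letters: `mulVecLin (Q̃(G₂ − G₁♮)Q̃ᵀ) = −(Q̃ ∘ (G₁♮ ∘ W ∘ G₂) ∘ Q̃ᵀ)`.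
[cite: Balaban1985BackgroundPropagators, (3.186) p.432, p.432 (after (3.186))] -/
theorem mulVecLin_sandwich_diff (K₁ W G₂ : Matrix b b ℝ) (hK₁ : IsUnit K₁.det) (hG₂ : (K₁ + W) * G₂ = 1)
    (Qt : Matrix τ b ℝ) :
    Matrix.mulVecLin (Qt * (G₂ - K₁⁻¹) * Qtᵀ) =
      -(Matrix.mulVecLin Qt ∘ₗ ((Matrix.mulVecLin K₁⁻¹ ∘ₗ (Matrix.mulVecLin W ∘ₗ Matrix.mulVecLin G₂)) ∘ₗ
        Matrix.mulVecLin Qtᵀ)) := by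
  rw [G2_sub_G1 K₁ W G₂ hK₁ hG₂, ← Matrix.mulVecLin_mul, ← Matrix.mulVecLin_mul, ← Matrix.mulVecLin_mul,
    ← Matrix.mulVecLin_mul]
  apply LinearMap.ext
  intro v
  simp only [Matrix.mulVecLin_apply, LinearMap.neg_apply, Matrix.mul_neg, Matrix.neg_mul, Matrix.neg_mulVec,
    Matrix.mul_assoc]

/-- **`(Q̃G₂Q̃*)⁻¹` «ANALYZED IN THE SAME WAY AS THE OPERATOR (Q′G′²Q′\*)⁻¹»** (p. 422, said of `(QGQ*)⁻¹`, `(QG₁Q*)⁻¹`; p. 432 lists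
`(QGQ*)⁻¹` among the operators `C⁽ᵏ⁾(Λ)` is expressed through): with `G₂` a two-sided inverse of `K₁ + W` (symmetric), `Q̃Q̃ᵀ` invertible, the
letters `G₁♮ = K₁⁻¹` (`B_G`), `W` (`c_W·m`), `G₂` (`B₂`), `Q̃` (`C_Q`), `Q̃ᵀ` (`C_Q′`) and THE (3.132)-TYPE INPUT FOR `G₁♮`: the block majorant `B_Me^{−δd}`
of `(Q̃G₁♮Q̃ᵀ)⁻¹` («|(QG₁Q\*)⁻¹(y, y′)| ≦ … e^{−δd(y,y′)} (3.132)»), `4σ ≦ δ`, and «Mα₀ sufficiently small»: `B_M·c_V·m·c² < 1` with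
`c_V = C_QB_Gc_WB₂C_Q′c⁴` ⟹ `Q̃G₁♮Q̃ᵀ > 0`; `(Q̃G₂Q̃ᵀ)⁻¹ = M₁⁻¹(I + VM₁⁻¹)⁻¹` (`M₁ = Q̃G₁♮Q̃ᵀ`, `V = Q̃(G₂ − G₁♮)Q̃ᵀ` of majorant `c_Vme^{−(δ−2σ)d}`);
`(Q̃G₂Q̃ᵀ)⁻¹ > 0`; the series `Σₙ M₁⁻¹(−VM₁⁻¹)ⁿ → (Q̃G₂Q̃ᵀ)⁻¹`; the block majorant `B_M(1 − B_Mc_Vmc²)⁻¹e^{−(δ−4σ)d}` — the resolvent step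
`B9Eq3186G2Perturbation.g2_expansion`/`g2_majorant` at `K₁ := Q̃G₁♮Q̃ᵀ`, `W := V`.
[cite: Balaban1985BackgroundPropagators, p.422 (before (3.132)), (3.132) p.422, (3.186) p.432, p.432 (after (3.186)), Thm 3.2 (3.48) p.398] [cite: Balaban1984PropagatorsII, (2.52)–(2.55) p.232, (2.61) p.234] -/
theorem qg2q_inverse (blkb : b → g.Site) (blkτ : τ → g.Site) (K₁ W G₂ : Matrix b b ℝ) (Qt : Matrix τ b ℝ)
    (hK₁ : K₁.PosDef) (hG₂t : G₂ᵀ = G₂) (hG₂ : (K₁ + W) * G₂ = 1) (hQ : IsUnit (Qt * Qtᵀ).det)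
    {BG cW m B₂ CQ CQ' BM δ σ c : ℝ}
    (htri : Triangle254 g) (hd : ∀ a b : g.Site, 0 ≤ g.dist a b) (hrow : RowSum g σ c) (hc0 : 0 ≤ c)
    (hBG : 0 ≤ BG) (hcW : 0 ≤ cW) (hm : 0 ≤ m) (hB₂ : 0 ≤ B₂) (hCQ : 0 ≤ CQ) (hCQ' : 0 ≤ CQ') (hBM : 0 ≤ BM)
    (hσ : 0 ≤ σ) (hσδ : σ + σ + σ + σ ≤ δ)
    (hG1 : HasMaj (BlockNorm.ofBlocks g blkb) (BlockNorm.ofBlocks g blkb) (Matrix.mulVecLin K₁⁻¹)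
      (fun a b => BG * Real.exp (-(δ * g.dist a b))))
    (hW : HasMaj (BlockNorm.ofBlocks g blkb) (BlockNorm.ofBlocks g blkb) (Matrix.mulVecLin W)
      (fun a b => cW * m * Real.exp (-(δ * g.dist a b))))
    (hG2 : HasMaj (BlockNorm.ofBlocks g blkb) (BlockNorm.ofBlocks g blkb) (Matrix.mulVecLin G₂)
      (fun a b => B₂ * Real.exp (-(δ * g.dist a b))))
    (hQt : HasMaj (BlockNorm.ofBlocks g blkb) (BlockNorm.ofBlocks g blkτ) (Matrix.mulVecLin Qt)
      (fun a b => CQ * Real.exp (-(δ * g.dist a b))))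
    (hQtt : HasMaj (BlockNorm.ofBlocks g blkτ) (BlockNorm.ofBlocks g blkb) (Matrix.mulVecLin Qtᵀ)
      (fun a b => CQ' * Real.exp (-(δ * g.dist a b))))
    (hM : HasMaj (BlockNorm.ofBlocks g blkτ) (BlockNorm.ofBlocks g blkτ) (Matrix.mulVecLin (Qt * K₁⁻¹ * Qtᵀ)⁻¹)
      (fun a b => BM * Real.exp (-(δ * g.dist a b))))
    (hsmall : BM * (CQ * (BG * (cW * B₂ * c) * c) * CQ' * c * c * m) * c * c < 1) :
    (Qt * K₁⁻¹ * Qtᵀ).PosDef ∧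
    (Qt * G₂ * Qtᵀ)⁻¹ =
      (Qt * K₁⁻¹ * Qtᵀ)⁻¹ * (1 + Qt * (G₂ - K₁⁻¹) * Qtᵀ * (Qt * K₁⁻¹ * Qtᵀ)⁻¹)⁻¹ ∧
    (Qt * G₂ * Qtᵀ)⁻¹.PosDef ∧
    HasSum (fun k : ℕ => (Qt * K₁⁻¹ * Qtᵀ)⁻¹ * ((-(Qt * (G₂ - K₁⁻¹) * Qtᵀ)) * (Qt * K₁⁻¹ * Qtᵀ)⁻¹) ^ k)
      (Qt * G₂ * Qtᵀ)⁻¹ ∧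
    HasMaj (BlockNorm.ofBlocks g blkτ) (BlockNorm.ofBlocks g blkτ) (Matrix.mulVecLin (Qt * G₂ * Qtᵀ)⁻¹)
      (fun a b => BM * (1 - BM * (CQ * (BG * (cW * B₂ * c) * c) * CQ' * c * c * m) * c * c)⁻¹ *
        Real.exp (-((δ - σ - σ - σ - σ) * g.dist a b))) := by
  have hK₁det : IsUnit K₁.det := (Matrix.isUnit_iff_isUnit_det _).mp hK₁.isUnit
  have hK₁t : K₁ᵀ = K₁ := by
    rw [← Matrix.conjTranspose_eq_transpose_of_trivial]; exact hK₁.isHermitian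
  -- `M₁ = Q̃G₁♮Q̃ᵀ > 0`
  have hM₁ : (Qt * K₁⁻¹ * Qtᵀ).PosDef := posDef_sandwich _ hK₁.inv Qt hQ
  -- the perturbation `V = Q̃(G₂ − G₁♮)Q̃ᵀ`, symmetric, small
  have hVt : (Qt * (G₂ - K₁⁻¹) * Qtᵀ)ᵀ = Qt * (G₂ - K₁⁻¹) * Qtᵀ := sandwich_sub_transpose K₁ G₂ hK₁t hG₂t Qt
  have hκ : (BlockNorm.ofBlocks g blkb).κ = 1 := rfl
  have hGWG := hasMaj_GWG (ρ := δ - σ) htri hd hrow hc0 hBG hcW hm hB₂ (by linarith) hσ (by linarith) hG1 hW hG2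
  rw [hκ] at hGWG
  have hQt' := hQt.of_rate_le hd hCQ (show δ - σ ≤ δ by linarith)
  have hQtt' := hQtt.of_rate_le hd hCQ' (show δ - σ ≤ δ by linarith)
  have hGWGc : 0 ≤ 1 * BG * (1 * (cW * m) * B₂ * c) * c := by
    have := mul_nonneg (mul_nonneg hBG (mul_nonneg (mul_nonneg (mul_nonneg hcW hm) hB₂) hc0)) hc0
    simpa only [one_mul] using this
  have hV' := hasMaj_sandwich (ρ := δ - σ - σ) htri hd hrow hc0 hCQ hGWGc hCQ' (by linarith) hσ (by linarith)
    hQt' hGWG hQtt'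
  rw [hκ] at hV'
  have hV : HasMaj (BlockNorm.ofBlocks g blkτ) (BlockNorm.ofBlocks g blkτ)
      (Matrix.mulVecLin (Qt * (G₂ - K₁⁻¹) * Qtᵀ))
      (fun a b => (CQ * (BG * (cW * B₂ * c) * c) * CQ' * c * c) * m * Real.exp (-((δ - σ - σ) * g.dist a b))) := by
    rw [mulVecLin_sandwich_diff K₁ W G₂ hK₁det hG₂ Qt]
    refine hV'.neg.mono fun a b => le_of_eq ?_
    ring
  -- the resolvent step of `B9Eq3186G2Perturbation` at `K₁ := M₁`, `W := V`
  have hcV : 0 ≤ CQ * (BG * (cW * B₂ * c) * c) * CQ' * c * c := by positivity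
  have hM' := hM.of_rate_le hd hBM (show δ - σ - σ ≤ δ by linarith)
  obtain ⟨-, hleft, -, -, hpos, -, hinv, hsum⟩ := g2_expansion blkτ (Qt * K₁⁻¹ * Qtᵀ) (Qt * (G₂ - K₁⁻¹) * Qtᵀ)
    hM₁ hVt htri hd hrow hc0 hBM hcV hm hσ (by linarith) hM' hV hsmall
  have hsplit : Qt * K₁⁻¹ * Qtᵀ + Qt * (G₂ - K₁⁻¹) * Qtᵀ = Qt * G₂ * Qtᵀ := (sandwich_split K₁⁻¹ G₂ Qt).symm
  rw [hsplit] at hleft hinv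
  have hM₁det : IsUnit (Qt * K₁⁻¹ * Qtᵀ).det := (Matrix.isUnit_iff_isUnit_det _).mp hM₁.isUnit
  have hmaj := g2_majorant blkτ (Qt * K₁⁻¹ * Qtᵀ) (Qt * (G₂ - K₁⁻¹) * Qtᵀ) (Qt * G₂ * Qtᵀ)⁻¹ hM₁det
    (by rw [hsplit, hinv]; exact hleft) htri hd hrow hc0 hBM hcV hm hσ (by linarith) hM' hV hsmall
  refine ⟨hM₁, hinv, ?_, ?_, hmaj⟩
  · rw [hinv]; exact hpos
  · rw [hinv]; exact hsum

end Inverse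

/-! ## §4 END TO END: `G̃₂ = G₂ − G₂Q̃*(Q̃G₂Q̃*)⁻¹Q̃G₂` (3.186) from Theorem 3.12-type inputs for `G₁♮` and the letters -/

section EndToEnd

variable {g : B6.Geometry} {b τ : Type} [Fintype b] [Fintype τ] [DecidableEq b] [DecidableEq τ]

/-- **G̃₂ OF (3.185)/(3.186) END TO END FROM THEOREM 3.12-TYPE INPUTS FOR `G₁♮`**: `K₁ = G₁♮⁻¹ > 0`, `W` symmetric (the new terms of
`B9Eq3186G2Perturbation`, majorant `c_W·m`), `Q̃Q̃ᵀ` invertible, the letters `G₁♮` (`B_G`), `Q̃` (`C_Q`), `Q̃ᵀ` (`C_Q′`), the (3.132)-type majorant `B_M`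
of `(Q̃G₁♮Q̃ᵀ)⁻¹`, all at the rate `δ`, `7σ ≦ δ`, and the two smallness conditions («Mα₀ sufficiently small»; `B₂ = B_G(1 − B_Gc_Wmc²)⁻¹`,
`c_V = C_QB_Gc_WB₂C_Q′c⁴`) ⟹ (i) `G₂ = (K₁ + W)⁻¹ > 0`, `Q̃G₂Q̃ᵀ > 0`; (ii) `(Q̃G₂Q̃ᵀ)⁻¹ > 0` with block majorant `B_H e^{−(δ−6σ)d}`,
`B_H = B_M(1 − B_Mc_Vmc²)⁻¹`; (iii) «G̃₂ = G₂ − G₂Q̃\*(Q̃G₂Q̃\*)⁻¹Q̃G₂ (3.186)» has the block majorant `(B₂ + B₂C_Q′B_HC_QB₂c⁴)·e^{−(δ−7σ)d}` — the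
input SHAPE `S` of `B9Thm315Decay.Hyp3185`/`kernel_3186` for the unit-lattice propagator, now resting on `G₁♮`-data alone («This way we can
express C⁽ᵏ⁾(Λ) in terms of the operators of the type G′, (Q′G′²Q′\*)⁻¹, G, (QGQ\*)⁻¹»).
[cite: Balaban1985BackgroundPropagators, (3.185)–(3.186) p.432, p.432 (after (3.186)), (3.132) p.422, Thm 3.15 p.432] [cite: Balaban1984PropagatorsII, (2.52)–(2.55) p.232, (2.61) p.234] -/
theorem gtilde2_of_letters (blkb : b → g.Site) (blkτ : τ → g.Site) (K₁ W : Matrix b b ℝ) (Qt : Matrix τ b ℝ)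
    (hK₁ : K₁.PosDef) (hWt : Wᵀ = W) (hQ : IsUnit (Qt * Qtᵀ).det)
    {BG cW m CQ CQ' BM δ σ c : ℝ}
    (htri : Triangle254 g) (hd : ∀ a b : g.Site, 0 ≤ g.dist a b) (hrow : RowSum g σ c) (hc0 : 0 ≤ c)
    (hBG : 0 ≤ BG) (hcW : 0 ≤ cW) (hm : 0 ≤ m) (hCQ : 0 ≤ CQ) (hCQ' : 0 ≤ CQ') (hBM : 0 ≤ BM) (hσ : 0 ≤ σ)
    (hσδ : 7 * σ ≤ δ)
    (hG1 : HasMaj (BlockNorm.ofBlocks g blkb) (BlockNorm.ofBlocks g blkb) (Matrix.mulVecLin K₁⁻¹)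
      (fun a b => BG * Real.exp (-(δ * g.dist a b))))
    (hW : HasMaj (BlockNorm.ofBlocks g blkb) (BlockNorm.ofBlocks g blkb) (Matrix.mulVecLin W)
      (fun a b => cW * m * Real.exp (-(δ * g.dist a b))))
    (hQt : HasMaj (BlockNorm.ofBlocks g blkb) (BlockNorm.ofBlocks g blkτ) (Matrix.mulVecLin Qt)
      (fun a b => CQ * Real.exp (-(δ * g.dist a b))))
    (hQtt : HasMaj (BlockNorm.ofBlocks g blkτ) (BlockNorm.ofBlocks g blkb) (Matrix.mulVecLin Qtᵀ)
      (fun a b => CQ' * Real.exp (-(δ * g.dist a b))))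
    (hM : HasMaj (BlockNorm.ofBlocks g blkτ) (BlockNorm.ofBlocks g blkτ) (Matrix.mulVecLin (Qt * K₁⁻¹ * Qtᵀ)⁻¹)
      (fun a b => BM * Real.exp (-(δ * g.dist a b))))
    (hsmall₁ : BG * (cW * m) * c * c < 1)
    (hsmall₂ : BM * (CQ * (BG * (cW * (BG * (1 - BG * (cW * m) * c * c)⁻¹) * c) * c) * CQ' * c * c * m) * c * c < 1) :
    -- (i) `G₂ := (K₁ + W)⁻¹ > 0` and `Q̃G₂Q̃ᵀ > 0`
    (K₁ + W)⁻¹.PosDef ∧ (Qt * (K₁ + W)⁻¹ * Qtᵀ).PosDef ∧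
    -- (ii) `(Q̃G₂Q̃ᵀ)⁻¹ > 0` with its block majorant («analyzed in the same way as (Q′G′²Q′*)⁻¹»)
    (Qt * (K₁ + W)⁻¹ * Qtᵀ)⁻¹.PosDef ∧
    HasMaj (BlockNorm.ofBlocks g blkτ) (BlockNorm.ofBlocks g blkτ) (Matrix.mulVecLin (Qt * (K₁ + W)⁻¹ * Qtᵀ)⁻¹)
      (fun a b => BM * (1 - BM * (CQ * (BG * (cW * (BG * (1 - BG * (cW * m) * c * c)⁻¹) * c) * c) * CQ' * c * c * m) *
        c * c)⁻¹ * Real.exp (-((δ - σ - σ - σ - σ - σ - σ) * g.dist a b))) ∧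
    -- (iii) the (3.186) operator `G̃₂ = G₂ − G₂Q̃ᵀ(Q̃G₂Q̃ᵀ)⁻¹Q̃G₂` has a block majorant of the same exponential shape
    HasMaj (BlockNorm.ofBlocks g blkb) (BlockNorm.ofBlocks g blkb)
      (Matrix.mulVecLin ((K₁ + W)⁻¹ - (K₁ + W)⁻¹ * Qtᵀ * (Qt * (K₁ + W)⁻¹ * Qtᵀ)⁻¹ * Qt * (K₁ + W)⁻¹))
      (fun a b => (BG * (1 - BG * (cW * m) * c * c)⁻¹ +
          BG * (1 - BG * (cW * m) * c * c)⁻¹ *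
            (CQ' * (BM * (1 - BM * (CQ * (BG * (cW * (BG * (1 - BG * (cW * m) * c * c)⁻¹) * c) * c) * CQ' * c * c * m) *
              c * c)⁻¹ * (CQ * (BG * (1 - BG * (cW * m) * c * c)⁻¹) * c) * c) * c) * c) *
        Real.exp (-((δ - 7 * σ) * g.dist a b))) := by
  set B₂ : ℝ := BG * (1 - BG * (cW * m) * c * c)⁻¹ with hB₂def
  set cV : ℝ := CQ * (BG * (cW * B₂ * c) * c) * CQ' * c * c with hcVdef
  set BH : ℝ := BM * (1 - BM * (cV * m) * c * c)⁻¹ with hBHdef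
  -- `G₂` from `B9Eq3186G2Perturbation` §3
  obtain ⟨-, hleft, -, hsymm, hpos, -, hinv, -⟩ :=
    g2_expansion blkb K₁ W hK₁ hWt htri hd hrow hc0 hBG hcW hm hσ (by linarith) hG1 hW hsmall₁
  have hK₁det : IsUnit K₁.det := (Matrix.isUnit_iff_isUnit_det _).mp hK₁.isUnit
  have hG₂eq : (K₁ + W) * (K₁ + W)⁻¹ = 1 := by rw [hinv]; exact hleft
  have hG₂pos : (K₁ + W)⁻¹.PosDef := by rw [hinv]; exact hpos
  have hG₂t : ((K₁ + W)⁻¹)ᵀ = (K₁ + W)⁻¹ := by rw [hinv]; exact hsymm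
  have hB₂0 : 0 ≤ B₂ := by
    have hq : 0 < 1 - BG * (cW * m) * c * c := by linarith
    exact mul_nonneg hBG (le_of_lt (inv_pos.mpr hq))
  have hG₂maj : HasMaj (BlockNorm.ofBlocks g blkb) (BlockNorm.ofBlocks g blkb) (Matrix.mulVecLin (K₁ + W)⁻¹)
      (fun a b => B₂ * Real.exp (-((δ - σ - σ) * g.dist a b))) :=
    g2_majorant blkb K₁ W (K₁ + W)⁻¹ hK₁det hG₂eq htri hd hrow hc0 hBG hcW hm hσ (by linarith) hG1 hW hsmall₁
  have hQG₂Q : (Qt * (K₁ + W)⁻¹ * Qtᵀ).PosDef := posDef_sandwich _ hG₂pos Qt hQ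
  -- `(Q̃G₂Q̃ᵀ)⁻¹` from §3 at the common rate `δ − 2σ`
  have h2σ : δ - σ - σ ≤ δ := by linarith
  obtain ⟨-, -, hHpos, -, hHmaj⟩ := qg2q_inverse blkb blkτ K₁ W (K₁ + W)⁻¹ Qt hK₁ hG₂t hG₂eq hQ htri hd hrow hc0
    hBG hcW hm hB₂0 hCQ hCQ' hBM hσ (by linarith) (hG1.of_rate_le hd hBG h2σ)
    (hW.of_rate_le hd (mul_nonneg hcW hm) h2σ) hG₂maj (hQt.of_rate_le hd hCQ h2σ) (hQtt.of_rate_le hd hCQ' h2σ)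
    (hM.of_rate_le hd hBM h2σ) hsmall₂
  -- the (3.186) word at the rate `δ − 7σ`
  have hcV0 : 0 ≤ cV := by positivity
  have hBH0 : 0 ≤ BH := by
    have hq : 0 < 1 - BM * (cV * m) * c * c := by linarith
    exact mul_nonneg hBM (le_of_lt (inv_pos.mpr hq))
  have h6σ : δ - σ - σ - σ - σ - σ - σ ≤ δ := by linarith
  have hword := hasMaj_3186_word (ρ := δ - 7 * σ) (δ := δ - σ - σ - σ - σ - σ - σ) htri hd hrow hc0 hB₂0 hCQ hCQ'
    hBH0 (by linarith) hσ (by linarith) (hG₂maj.of_rate_le hd hB₂0 (by linarith)) (hQt.of_rate_le hd hCQ h6σ)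
    (hQtt.of_rate_le hd hCQ' h6σ) hHmaj
  have hκb : (BlockNorm.ofBlocks g blkb).κ = 1 := rfl
  have hκτ : (BlockNorm.ofBlocks g blkτ).κ = 1 := rfl
  rw [hκb, hκτ] at hword
  refine ⟨hG₂pos, hQG₂Q, hHpos, hHmaj, ?_⟩
  have hmat : Matrix.mulVecLin ((K₁ + W)⁻¹ - (K₁ + W)⁻¹ * Qtᵀ * (Qt * (K₁ + W)⁻¹ * Qtᵀ)⁻¹ * Qt * (K₁ + W)⁻¹) =
      Matrix.mulVecLin (K₁ + W)⁻¹ - Matrix.mulVecLin (K₁ + W)⁻¹ ∘ₗ (Matrix.mulVecLin Qtᵀ ∘ₗ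
        (Matrix.mulVecLin (Qt * (K₁ + W)⁻¹ * Qtᵀ)⁻¹ ∘ₗ (Matrix.mulVecLin Qt ∘ₗ Matrix.mulVecLin (K₁ + W)⁻¹))) := by
    apply LinearMap.ext
    intro v
    simp only [Matrix.mulVecLin_apply, LinearMap.sub_apply, LinearMap.comp_apply, Matrix.sub_mulVec,
      Matrix.mulVec_mulVec, Matrix.mul_assoc]
  rw [hmat]
  refine hword.mono fun a b => le_of_eq ?_
  simp only [one_mul]

end EndToEnd

section FlucCov

variable {b τ : Type*} [Fintype b] [Fintype τ] [DecidableEq b] [DecidableEq τ]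

/-- **the covariance of (3.183)/(3.185) IS the operator of §4**: when `K + aQ̃ᵀQ̃ = K₁ + W` (`B9Eq3186G2Perturbation.g2_of_letters` (i) with
`K = K₃₁₈₃`), `K₁ + W > 0` and `Q̃Q̃ᵀ` invertible, `flucCov K Q̃ = G₂ − G₂Q̃ᵀ(Q̃G₂Q̃ᵀ)⁻¹Q̃G₂` with `G₂ = (K₁ + W)⁻¹` — so §4 (iii) is a block
majorant of the `G̃₂` of «C⁽ᵏ⁾(Λ) = (I + D̄μ)QG̃₂Q\*(I + μ\*D̄\*) (3.185)». [cite: Balaban1985BackgroundPropagators, (3.185)–(3.186) p.432] -/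
theorem flucCov_eq_of_posDef (K K₁ W : Matrix b b ℝ) (Qt : Matrix τ b ℝ) (a : ℝ) (hK : K + a • (Qtᵀ * Qt) = K₁ + W)
    (hK₂ : (K₁ + W).PosDef) (hQ : IsUnit (Qt * Qtᵀ).det) :
    Beta.CompositionSingular.flucCov K Qt =
      (K₁ + W)⁻¹ - (K₁ + W)⁻¹ * Qtᵀ * (Qt * (K₁ + W)⁻¹ * Qtᵀ)⁻¹ * Qt * (K₁ + W)⁻¹ := by
  have h := (eq_3186_of_posDef K Qt a (by rw [hK]; exact hK₂) hQ).2
  rw [hK] at h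
  exact h

end FlucCov

/-! ## §5 (v1.1) KERNEL FORM: the entrywise bound of the unit-lattice sandwich `S = QG̃₂Qᵀ` — the `hS` shape of `B9Thm315Decay.Rep3185` -/

section KernelForm

variable {g : B6.Geometry} {X₁ X₂ : Type} [Fintype X₁] [Fintype X₂] [DecidableEq X₁]

/-- READOUT: a non-negative block majorant between sharp-block sup sizes bounds every matrix entry, `|M(x, x′)| ≤ K(y(x), y(x′))` — evaluate on the
point mass at `x′` (cf. `T4EtaRateDefectSite.entry_le_of_hasMaj` for that file's `entry`; re-derived for `Matrix` entries so that this module's imports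
stay inside the B9 lineage). [cite: Balaban1984PropagatorsII, (2.51) p.232] -/
theorem abs_entry_le_of_hasMaj (blk₁ : X₁ → g.Site) (blk₂ : X₂ → g.Site) (M : Matrix X₂ X₁ ℝ) {K : g.Site → g.Site → ℝ}
    (hK : ∀ y y', 0 ≤ K y y')
    (h : HasMaj (BlockNorm.ofBlocks g blk₁) (BlockNorm.ofBlocks g blk₂) (Matrix.mulVecLin M) K) (x : X₂) (x' : X₁) :
    |M x x'| ≤ K (blk₂ x) (blk₁ x') := by
  classical
  have hloc : (BlockNorm.ofBlocks g blk₁).IsLoc (blk₁ x') (Pi.single x' (1 : ℝ)) := by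
    intro z hz
    have : z ≠ x' := fun h => hz (h ▸ rfl)
    simp [this]
  have hle1 : (BlockNorm.ofBlocks g blk₁).loc (blk₁ x') (Pi.single x' (1 : ℝ)) ≤ 1 := by
    show (⨆ z : X₁, if blk₁ z = blk₁ x' then |(Pi.single x' (1 : ℝ) : X₁ → ℝ) z| else 0) ≤ 1
    haveI : Nonempty X₁ := ⟨x'⟩
    refine ciSup_le fun z => ?_
    by_cases hz : blk₁ z = blk₁ x'
    · simp only [hz, if_true, Pi.single_apply]
      split_ifs <;> simp
    · simp [hz]
  have hpt : |M x x'| ≤ (BlockNorm.ofBlocks g blk₂).loc (blk₂ x) (Matrix.mulVecLin M (Pi.single x' 1)) := by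
    show |M x x'| ≤ ⨆ z : X₂, if blk₂ z = blk₂ x then |Matrix.mulVecLin M (Pi.single x' (1 : ℝ)) z| else 0
    refine le_trans ?_ (le_ciSup (Finite.bddAbove_range _) x)
    simp [Matrix.mulVec_single]
  have H := h (blk₁ x') (Pi.single x' 1) hloc (blk₂ x)
  exact hpt.trans (H.trans (by simpa using mul_le_mul_of_nonneg_left hle1 (hK _ _)))

variable {b P : Type} [Fintype b] [Fintype P] [DecidableEq P]

/-- **THE `hS` SHAPE OF `B9Thm315Decay.Rep3185` FROM THE BLOCK MAJORANT OF `G̃₂`**: with `G̃₂` of majorant `B·e^{−δd}` on the fine bonds (§4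
`gtilde2_of_letters` (iii)) and the unit-lattice averaging `Q : b → P`, `Qᵀ` (letters `C_Q`, `C_Q′`), the sandwich `S = QG̃₂Qᵀ` of (3.185) satisfies
`|S(p, q)| ≤ C_Q(BC_Q′c)c·e^{−ρ·d(y(p), y(q))}` for `ρ + σ ≦ δ` — an ENTRYWISE kernel bound in the multiscale distance of the block map (the comparison
with the unit-lattice `|y − y′|` is `B9Thm315Decay.decay_of_affine_comparison`, the dressing by `I + D̄μ` is `B9Eq3187Op`/`B9Eq3169Comb`).
[cite: Balaban1985BackgroundPropagators, (3.185)–(3.187) p.432] [cite: Balaban1984PropagatorsII, (2.51)–(2.55) p.232, (2.61) p.234] -/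
theorem kernel_of_sandwich (blkb : b → g.Site) (blkP : P → g.Site) (Gt : Matrix b b ℝ) (Q : Matrix P b ℝ) {B CQ CQ' δ ρ σ c : ℝ}
    (htri : Triangle254 g) (hd : ∀ a b : g.Site, 0 ≤ g.dist a b) (hrow : RowSum g σ c) (hc0 : 0 ≤ c)
    (hB : 0 ≤ B) (hCQ : 0 ≤ CQ) (hCQ' : 0 ≤ CQ') (hρ : 0 ≤ ρ) (hσ : 0 ≤ σ) (hρδ : ρ + σ ≤ δ)
    (hGt : HasMaj (BlockNorm.ofBlocks g blkb) (BlockNorm.ofBlocks g blkb) (Matrix.mulVecLin Gt)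
      (fun a b => B * Real.exp (-(δ * g.dist a b))))
    (hQ : HasMaj (BlockNorm.ofBlocks g blkb) (BlockNorm.ofBlocks g blkP) (Matrix.mulVecLin Q)
      (fun a b => CQ * Real.exp (-(δ * g.dist a b))))
    (hQt : HasMaj (BlockNorm.ofBlocks g blkP) (BlockNorm.ofBlocks g blkb) (Matrix.mulVecLin Qᵀ)
      (fun a b => CQ' * Real.exp (-(δ * g.dist a b)))) :
    ∀ p q, |(Q * Gt * Qᵀ) p q| ≤ CQ * (B * CQ' * c) * c * Real.exp (-(ρ * g.dist (blkP p) (blkP q))) := by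
  have hw := hasMaj_sandwich (ρ := ρ) htri hd hrow hc0 hCQ hB hCQ' hρ hσ hρδ hQ hGt hQt
  have hκ : (BlockNorm.ofBlocks g blkb).κ = 1 := rfl
  rw [hκ, one_mul, one_mul, ← Matrix.mulVecLin_mul, ← Matrix.mulVecLin_mul, ← Matrix.mul_assoc] at hw
  intro p q
  exact abs_entry_le_of_hasMaj blkP blkP (Q * Gt * Qᵀ)
    (fun y y' => mul_nonneg (mul_nonneg (mul_nonneg hCQ (mul_nonneg (mul_nonneg hB hCQ') hc0)) hc0) (Real.exp_nonneg _)) hw p q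

end KernelForm

end Literature.MathematicalPhysics.QuantumFieldTheory.Balaban1983to89.B9Eq3186QG2QInv

end
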